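import Literature.Probability.LatticeModels.FKPrimitive
import Literature.Probability.LatticeModels.FKPrimitiveLaplacian
import HarnessLib

/-!
# The discrete primitive of the FK observable: interior regions, boundary structure, `0 ≤ H ≤ 1`

Topic `Literature/Probability/LatticeModels`; an instalment of the discharge programme for
crit-ising.S18 (`Sweep1Proofs.lean`: Smirnov's Theorem 2.2), nodes 2–3 of the DAG recorded there,
building on `FKPrimitive.lean` (the primitive `H = Im ∫ F²` and its boundary behaviour) and
`FKPrimitiveLaplacian.lean` (Lemma 3.8 one lattice step inside the arcs). Everything is proved.

* `DiscreteDobrushin.interiorSites E` (sites all four of whose edges are interior in Smirnov's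
  sense, `IsInteriorEdge`) and `DiscreteDobrushin.interiorFaces E` (faces all four of whose sides are
  interior): the regions where `Hw` is superharmonic and `Hb` subharmonic for any FK primitive
  (`IsFKPrimitive.superharmonicOn_interiorSites`, `IsFKPrimitive.subharmonicOn_interiorFaces`);
  both finite.
* **Boundary structure** (the tree's form of "by values of `H` on the boundary we mean its values
  on the outside squares adjacent to `Ω`", §3 before Lemma 3.10): a site off the discrete boundary
  carrying an inner face but not interior has a neighbour on the free arc `B`
  (`exists_add_cornerUnit_mem_zdArcB`), and there `Hw = H(b) - |F|²` with the flux of the dart into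
  `B` (`IsFKPrimitive.hw_eq_of_neighbour_mem_zdArcB`); an inner face that is not interior has a
  corner on `A ∪ B` (`exists_corner_mem_arcs_of_not_interiorFace`).
* **Global bounds** (`IsFKPrimitive.hb_le`, `IsFKPrimitive.le_hw`, and corollaries): if `Hw` takes one
  value `H_A` at the `A`-sites cornering an inner face and one value `H_B` at the `B`-sites
  cornering an inner face (the arc-connectivity input, hypotheses `hcA`, `hcB`), then
  `H_B = H_A + 1` and `H_A ≤ Hw ≤ Hb ≤ H_B` throughout: the maximum principle for `Hb` on the
  interior faces and the minimum principle for `Hw` on the interior sites (`LatticeLaplacian.lean`),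
  the boundary layers being controlled by the structure lemmas and `|F|² ≤ 1`. This is the a priori
  boundedness `0 ≤ H ≤ 1` used throughout §5.

## References

* S. Smirnov, *Conformal invariance in random cluster models. I*, Ann. of Math. 172 (2010)
  1435–1467: §3.3 (boundary values of `H`), Lemma 3.8, Lemma 3.10, Lemma 4.11, proof of Lemma 5.2
  (maximum principle) — bib key `Smirnov2010`.
-/

noncomputable section

open MeasureTheory

namespace Literature.Probability.LatticeModels

open Finset SimpleGraph

namespace DiscreteDobrushin

/-- The **interior sites**: sites all four of whose edges are interior (`IsInteriorEdge`) — Smirnov's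
"interior white squares" (all four corner vertices interior, Lemma 3.8), where the primitive `Hw`
is superharmonic. [cite: Smirnov2010, §3 and Lemma 3.8] -/
def interiorSites (E : DiscreteDobrushin) : Set (Site 2) := {u | ∀ k : Fin 4, E.IsInteriorEdge u k}

/-- The **interior faces**: faces all four of whose sides are interior — Smirnov's "interior black
squares", where `Hb` is subharmonic. [cite: Smirnov2010, §3 and Lemma 3.8] -/
def interiorFaces (E : DiscreteDobrushin) : Set (Site 2) := {f | ∀ j : Fin 4, E.IsInteriorEdge (f + cornerOff j) j}

variable {E : DiscreteDobrushin}

/-- Interior sites are sites of `Ω_δ`. [cite: Smirnov2010, §3] -/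
theorem interiorSites_subset_meshDomain : E.interiorSites ⊆ meshDomain E.Ω E.δ := fun u hu =>
  mem_meshDomain_of_mem_edge (hu 0).mem_edgeSet (by rw [cSrc]; exact Sym2.mem_mk_left _ _)

/-- Interior faces are inner faces. [cite: Smirnov2010, §3] -/
theorem interiorFaces_subset_innerFaces : E.interiorFaces ⊆ E.innerFaces := fun f hf => by
  have := (hf 0).inner; rwa [faceAt_add_cornerOff] at this

/-- The interior sites form a finite set (admissible data). [cite: Smirnov2010, §3] -/
theorem interiorSites_finite (hE : E.IsZdAdmissible) : E.interiorSites.Finite :=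
  (meshDomain_finite hE.isBounded hE.delta_pos).subset interiorSites_subset_meshDomain

/-- The interior faces form a finite set (admissible data). [cite: Smirnov2010, §3] -/
theorem interiorFaces_finite (hE : E.IsZdAdmissible) : E.interiorFaces.Finite :=
  (E.innerFaces_finite hE.isBounded hE.delta_pos).subset interiorFaces_subset_innerFaces

/-- The face across an edge of an interior face is inner (so the outer boundary of the interior
faces consists of inner faces). [cite: Smirnov2010, §3] -/
theorem isInnerFace_add_cornerUnit_of_interiorFace {f : Site 2} (hf : f ∈ E.interiorFaces) (k : Fin 4) :
    E.IsInnerFace (f + cornerUnit k) := by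
  have := (hf (k + 1)).inner'
  rwa [faceAt_face_corner_add_three, show k + 1 + 3 = k by omega] at this

/-- **A non-interior site off the discrete boundary, cornering an inner face, has a neighbour on
the free arc** (admissible data): all its faces are inner, so the only way one of its edges fails to
be interior is by touching `B`. [cite: Smirnov2010, §3.3 (squares adjacent to the boundary)] -/
theorem exists_add_cornerUnit_mem_zdArcB {v : Site 2} (hv : v ∉ E.zdBoundary)
    (hinner : ∃ k, E.IsInnerFace (faceAt v k)) (hint : v ∉ E.interiorSites) :
    (∀ j, E.IsInnerFace (faceAt v j)) ∧ ∃ k : Fin 4, v + cornerUnit k ∈ E.zdArcB := by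
  have hall : ∀ j, E.IsInnerFace (faceAt v j) := by
    rcases E.faces_dichotomy hv with h | h
    · exact h
    · obtain ⟨k, hk⟩ := hinner; exact absurd hk (h k)
  refine ⟨hall, ?_⟩
  simp only [interiorSites, Set.mem_setOf_eq, not_forall] at hint
  obtain ⟨k, hk⟩ := hint
  refine ⟨k, ?_⟩
  by_contra hB
  have hvA : v ∉ E.zdArcA := fun h => hv (E.zdArcA_subset_zdBoundary h)
  have hvB : v ∉ E.zdArcB := fun h => hv (E.zdArcB_subset_zdBoundary h)
  exact hk
    { mem_edgeSet := adj_of_isInnerFace_faceAt (hall k) (Or.inl rfl)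
      not_mem_zdArcB := fun x hx => by
        rw [cSrc] at hx
        rcases Sym2.mem_iff.1 hx with rfl | rfl
        · exact hvB
        · exact hB
      not_arcA := fun h => hvA h.1
      inner := hall k
      inner' := hall (k + 3) }

/-- **A non-interior inner face has a corner on the arcs** (admissible data): a side that is not
interior touches `B`, or is an `A`–`A` edge, or borders a non-inner face and is then a face-boundary
edge, whose endpoints lie on `A ∪ B`. [cite: Smirnov2010, §3.3 (squares adjacent to the boundary)] -/
theorem exists_corner_mem_arcs_of_not_interiorFace (hE : E.IsZdAdmissible) {f : Site 2} (hf : E.IsInnerFace f)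
    (hint : f ∉ E.interiorFaces) : ∃ j : Fin 4, f + cornerOff j ∈ E.zdArcA ∪ E.zdArcB := by
  simp only [interiorFaces, Set.mem_setOf_eq, not_forall] at hint
  obtain ⟨j, hj⟩ := hint
  by_contra hno
  push Not at hno
  have hfj : E.IsInnerFace (faceAt (f + cornerOff j) j) := by rw [faceAt_add_cornerOff]; exact hf
  have hadj : (discreteDomainGraph E.Ω E.δ).Adj (f + cornerOff j) (f + cornerOff j + cornerUnit j) :=
    adj_of_isInnerFace_faceAt hfj (Or.inl rfl)
  have hsucc : f + cornerOff j + cornerUnit j = f + cornerOff (j + 1) := by rw [add_cornerOff_succ]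
  -- the face across side `j` is inner: otherwise side `j` is a face-boundary edge
  have hinner' : E.IsInnerFace (faceAt (f + cornerOff j) (j + 3)) := by
    by_contra hno'
    have hfb : E.IsFaceBoundaryEdge (f + cornerOff j) (f + cornerOff j + cornerUnit j) :=
      ⟨hadj, ⟨_, hfj, isCorner_faceAt _ j, (isCorner_add_faceAt_iff _ j j).2 (Or.inl rfl)⟩,
        ⟨_, hno', isCorner_faceAt _ (j + 3), (isCorner_add_faceAt_iff _ j (j + 3)).2 (Or.inr rfl)⟩⟩
    exact hno j (hE.arcs_cover_faceBoundary hfb).1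
  exact hj
    { mem_edgeSet := hadj
      not_mem_zdArcB := fun x hx => by
        rw [cSrc] at hx
        rcases Sym2.mem_iff.1 hx with rfl | rfl
        · exact fun h => hno j (Or.inr h)
        · exact fun h => hno (j + 1) (by rw [← hsucc]; exact Or.inr h)
      not_arcA := fun h => hno j (Or.inl h.1)
      inner := hfj
      inner' := hinner' }

end DiscreteDobrushin

/-! ### Laplacian signs of an FK primitive on the interior regions -/

namespace IsFKPrimitive

variable {E : DiscreteDobrushin} [Fintype (meshDomain E.Ω E.δ)] {hE : E.IsZdAdmissible} {Hw Hb : Site 2 → ℝ}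

/-- **`Hw` is superharmonic on the interior sites** (Lemma 3.8). [cite: Smirnov2010, Lemma 3.8] -/
theorem superharmonicOn_interiorSites (h : IsFKPrimitive E hE Hw Hb)
    (hA : ((discreteDomainGraph E.Ω E.δ).induce E.zdArcA).Preconnected) :
    IsLatticeSuperharmonicOn Hw E.interiorSites :=
  superharmonic_hw hE hA (fun u hu k => hu k) fun u hu k => by
    refine ⟨h (u, k) (hu k).inner, ?_⟩
    have := h (u + cornerUnit k, k + 1) (by
      change E.IsInnerFace (faceAt (u + cornerUnit k) (k + 1)); rw [faceAt_add_unit_succ]; exact (hu k).inner)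
    simp only [cFace] at this
    rwa [faceAt_add_unit_succ] at this

/-- **`Hb` is subharmonic on the interior faces** (Lemma 3.8). [cite: Smirnov2010, Lemma 3.8] -/
theorem subharmonicOn_interiorFaces (h : IsFKPrimitive E hE Hw Hb)
    (hA : ((discreteDomainGraph E.Ω E.δ).induce E.zdArcA).Preconnected) :
    IsLatticeSubharmonicOn Hb E.interiorFaces :=
  subharmonic_hb hE hA (fun f hf j => hf j) fun f hf j => by
    constructor
    · have := h (f + cornerOff j, j) (hf j).inner
      simp only [cFace] at this
      rwa [faceAt_add_cornerOff] at this
    · have := h (f + cornerOff j, j + 3) (hf j).inner'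
      simp only [cFace] at this
      rwa [faceAt_face_corner_add_three] at this

/-! ### Fluxes are at most one -/

omit [Fintype (meshDomain E.Ω E.δ)] in
/-- `|F(q)|² ≤ 1` (a passage probability is at most one). [cite: Smirnov2010, proof of Lemma 4.11] -/
theorem _root_.Literature.Probability.LatticeModels.dartFlux_le_one [Fintype (meshDomain E.Ω E.δ)]
    (hE : E.IsZdAdmissible) (q : Site 2 × Fin 4) : dartFlux E hE q ≤ 1 := by
  refine (dartFlux_le_passageProb_sq hE q).trans ?_
  have h0 : 0 ≤ (fkDobrushinMeasure E).real {ω | cSrc q ∈ fkInterface E ω} := measureReal_nonneg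
  have h1 : (fkDobrushinMeasure E).real {ω | cSrc q ∈ fkInterface E ω} ≤ 1 := measureReal_le_one
  nlinarith

/-! ### Boundary layers -/

/-- **`Hw` one step off the free arc.** At a site `v` off the discrete boundary, all of whose faces
are inner, with a neighbour `v + e_k` on `B`: `Hw v = Hw (v + e_k) - |F(v, k)|²` (the face
`faceAt v k` carries the value `Hw (v + e_k)` by `hb_eq_hw_of_mem_zdArcB`).
[cite: Smirnov2010, §3.3 and Lemma 4.11] -/
theorem hw_eq_of_neighbour_mem_zdArcB (h : IsFKPrimitive E hE Hw Hb) {v : Site 2}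
    (hall : ∀ j, E.IsInnerFace (faceAt v j)) {k : Fin 4} (hb : v + cornerUnit k ∈ E.zdArcB) :
    Hw v = Hw (v + cornerUnit k) - dartFlux E hE (v, k) := by
  have p := h (v, k) (hall k)
  have hf : E.IsInnerFace (faceAt (v + cornerUnit k) (k + 1)) := by rw [faceAt_add_unit_succ]; exact hall k
  have q := h.hb_eq_hw_of_mem_zdArcB hb hf
  rw [faceAt_add_unit_succ] at q
  simp only [cFace] at p
  linarith

/-! ### Global bounds -/

variable (h : IsFKPrimitive E hE Hw Hb) (hA : ((discreteDomainGraph E.Ω E.δ).induce E.zdArcA).Preconnected)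
  (hcA : ∀ a ∈ E.zdArcA, (∃ k, E.IsInnerFace (faceAt a k)) → Hw a = Hw (DiscreteDobrushin.startCorner hE).1)
  (hcB : ∀ b ∈ E.zdArcB, (∃ k, E.IsInnerFace (faceAt b k)) →
    Hw b = Hw ((DiscreteDobrushin.startCorner hE).1 + cornerUnit (DiscreteDobrushin.startCorner hE).2))

include h hA hcA hcB

/-- **Upper bound: `Hb ≤ H_B` on every inner face** (maximum principle for the subharmonic `Hb` on
the interior faces; a non-interior inner face has a corner on `B`, where `Hb = H_B`, or on `A`, where
`Hb = H_A + |F|² ≤ H_A + 1 = H_B`). [cite: Smirnov2010, proof of Lemma 5.2 (maximum principle)] -/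
theorem hb_le {f : Site 2} (hf : E.IsInnerFace f) :
    Hb f ≤ Hw ((DiscreteDobrushin.startCorner hE).1 + cornerUnit (DiscreteDobrushin.startCorner hE).2) := by
  have hjump := h.jump_startCorner
  -- non-interior inner faces
  have key : ∀ f : Site 2, E.IsInnerFace f → f ∉ E.interiorFaces →
      Hb f ≤ Hw ((DiscreteDobrushin.startCorner hE).1 + cornerUnit (DiscreteDobrushin.startCorner hE).2) := by
    intro f hf hint
    obtain ⟨j, hj⟩ := DiscreteDobrushin.exists_corner_mem_arcs_of_not_interiorFace hE hf hint
    have hfj : E.IsInnerFace (faceAt (f + cornerOff j) j) := by rw [faceAt_add_cornerOff]; exact hf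
    rcases hj with hjA | hjB
    · have p := h (f + cornerOff j, j) hfj
      simp only [cFace] at p
      rw [faceAt_add_cornerOff] at p
      have hca := hcA _ hjA ⟨j, hfj⟩
      linarith [dartFlux_le_one hE (f + cornerOff j, j)]
    · have := h.hb_eq_hw_of_mem_zdArcB hjB hfj
      rw [faceAt_add_cornerOff] at this
      rw [this, hcB _ hjB ⟨j, hfj⟩]
  by_cases hint : f ∈ E.interiorFaces
  · refine (h.subharmonicOn_interiorFaces hA).le_of_forall_boundary_le (DiscreteDobrushin.interiorFaces_finite hE)
      (fun w hw => ?_) f hint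
    obtain ⟨hwS, f', hf', k, rfl⟩ := hw
    exact key _ (DiscreteDobrushin.isInnerFace_add_cornerUnit_of_interiorFace hf' k) hwS
  · exact key f hf hint

/-- **Lower bound: `H_A ≤ Hw` at every site cornering an inner face** (minimum principle for the
superharmonic `Hw` on the interior sites; a non-interior such site lies on `A` (value `H_A`), on `B`
(value `H_B = H_A + 1`), or next to `B`, where `Hw = H_B - |F|² ≥ H_A`).
[cite: Smirnov2010, proof of Lemma 5.2 (maximum principle)] -/
theorem le_hw {v : Site 2} (hv : ∃ k, E.IsInnerFace (faceAt v k)) :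
    Hw (DiscreteDobrushin.startCorner hE).1 ≤ Hw v := by
  have hjump := h.jump_startCorner
  -- sites cornering an inner face that are not interior
  have key : ∀ v : Site 2, (∃ k, E.IsInnerFace (faceAt v k)) → v ∉ E.interiorSites →
      Hw (DiscreteDobrushin.startCorner hE).1 ≤ Hw v := by
    intro v hv hint
    by_cases hvA : v ∈ E.zdArcA
    · rw [hcA v hvA hv]
    by_cases hvB : v ∈ E.zdArcB
    · rw [hcB v hvB hv]; linarith
    have hvbd : v ∉ E.zdBoundary := fun h' => by
      rcases hE.zdBoundary_subset h' with h' | h'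
      · exact hvA h'
      · exact hvB h'
    obtain ⟨hall, k, hk⟩ := DiscreteDobrushin.exists_add_cornerUnit_mem_zdArcB hvbd hv hint
    rw [h.hw_eq_of_neighbour_mem_zdArcB hall hk, hcB _ hk ⟨k + 1, by rw [faceAt_add_unit_succ]; exact hall k⟩]
    linarith [dartFlux_le_one hE (v, k)]
  by_cases hint : v ∈ E.interiorSites
  · refine (h.superharmonicOn_interiorSites hA).ge_of_forall_boundary_ge (DiscreteDobrushin.interiorSites_finite hE)
      (fun w hw => ?_) v hint
    obtain ⟨hwS, u, hu, k, rfl⟩ := hw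
    exact key _ ⟨k + 1, by rw [faceAt_add_unit_succ]; exact (hu k).inner⟩ hwS
  · exact key v hv hint

/-- **`H_A ≤ Hw ≤ Hb ≤ H_B` across every corner of every inner face.**
[cite: Smirnov2010, proof of Lemma 5.2 (maximum principle)] -/
theorem bounds (q : Site 2 × Fin 4) (hq : E.IsInnerFace (cFace q)) :
    Hw (DiscreteDobrushin.startCorner hE).1 ≤ Hw q.1 ∧ Hw q.1 ≤ Hb (cFace q) ∧
      Hb (cFace q) ≤ Hw ((DiscreteDobrushin.startCorner hE).1 + cornerUnit (DiscreteDobrushin.startCorner hE).2) :=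
  ⟨le_hw h hA hcA hcB ⟨q.2, hq⟩, h.hw_le_hb hq, hb_le h hA hcA hcB hq⟩

/-- `Hw` takes values in `[H_A, H_B]` at every site cornering an inner face. [cite: Smirnov2010, proof of Lemma 5.2] -/
theorem hw_mem_Icc {v : Site 2} (hv : ∃ k, E.IsInnerFace (faceAt v k)) :
    Hw v ∈ Set.Icc (Hw (DiscreteDobrushin.startCorner hE).1)
      (Hw ((DiscreteDobrushin.startCorner hE).1 + cornerUnit (DiscreteDobrushin.startCorner hE).2)) := by
  obtain ⟨k, hk⟩ := hv
  obtain ⟨h1, h2, h3⟩ := bounds h hA hcA hcB (v, k) hk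
  exact ⟨h1, h2.trans h3⟩

/-- `Hb` takes values in `[H_A, H_B]` at every inner face. [cite: Smirnov2010, proof of Lemma 5.2] -/
theorem hb_mem_Icc {f : Site 2} (hf : E.IsInnerFace f) :
    Hb f ∈ Set.Icc (Hw (DiscreteDobrushin.startCorner hE).1)
      (Hw ((DiscreteDobrushin.startCorner hE).1 + cornerUnit (DiscreteDobrushin.startCorner hE).2)) := by
  have hf0 : E.IsInnerFace (cFace ((f + cornerOff 0, 0) : Site 2 × Fin 4)) := by
    change E.IsInnerFace (faceAt (f + cornerOff 0) 0); rw [faceAt_add_cornerOff]; exact hf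
  obtain ⟨h1, h2, h3⟩ := bounds h hA hcA hcB (f + cornerOff 0, 0) hf0
  have e : cFace ((f + cornerOff 0, 0) : Site 2 × Fin 4) = f := faceAt_add_cornerOff f 0
  rw [e] at h2 h3
  exact ⟨h1.trans h2, h3⟩

end IsFKPrimitive

end Literature.Probability.LatticeModels
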